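import Summits.PneNP.PneNP.Theorems.HeisenbergSparsestCutSparsestCutVerifier
import Literature.Computability.Complexity.KarpCliqueNP
import Literature.Computability.Complexity.CodeFPLists
import Literature.Computability.Complexity.CanonicalCodes
import Literature.Computability.Complexity.PRelHierarchy
import Literature.Computability.Complexity.PromiseProofs
import Literature.Computability.Complexity.NondeterministicProofs

/-!
# Route HeisenbergSparsestCut — `SparsestCutDecisionInNP` (stmt-PneNP-2290)

The YES-language of the sparsest-cut gap problem — codes `⟨⟨bin n, entries⟩, ⟨bin a, bin b⟩⟩` of an `ℕ`-matrix `w` on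
`Fin n` with a threshold `a/b` such that some cut `S` with positive demand `dem S = Σ_{i∈S,j∉S} w↓` has
`cap S · b ≤ a · dem S` (`cap` from the upper, `dem` from the lower triangle) — is in `NP` BY DEFINITION
(`NP = ∃^poly P`): the certificate is the characteristic vector of `S` (`n ≤ |x|` bits) and the verifier is one typed
`CodeFP` program on `(x, y)`: the weighted-graph code test of `MaxCutNP` on the padded word `⟨fstF x, bin 0⟩`, pairing and
canonical-numeral tests for `⟨bin a, bin b⟩`, and the cut test of `HeisenbergSparsestCutSparsestCutVerifier` on the decoded
data (every string decodes to SOME data, so the program's value is known on all inputs).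
-/

set_option linter.dupNamespace false -- `Summit.PneNP.PneNP.…`: summit = sub-problem name (D-0017 single-conjunct layout)

namespace Summit.PneNP.PneNP.Theorems

open _root_.Computability Polynomial Finset
open Literature.Computability.Complexity Literature.Computability.Complexity.CodeFP
  Literature.Computability.Complexity.Brick

/-- The code of a gap instance `(⟨n, w⟩, (a, b))`, field by field. [cite: Karp1972, §4 Main Theorem, problem 21] [folklore] -/
theorem heisenbergSparsestCut_instEnc_encode (n : ℕ) (w : Fin n → Fin n → ℕ) (a b : ℕ) :
    (encodingNatMatrix.pairBool (encodingNatBool.pairBool encodingNatBool)).encode (⟨n, w⟩, (a, b)) =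
      boolPair (boolPair (encodeNat n) (encodingListNatBool.encode (MaxCutNP.entriesL n w)))
        (boolPair (encodeNat a) (encodeNat b)) :=
  rfl

/-- `n` certificate bits fit below the code length (indeed `n²` do). [folklore] -/
theorem heisenbergSparsestCut_n_le_length_encode (n : ℕ) (w : Fin n → Fin n → ℕ) (a b : ℕ) :
    n ≤ ((encodingNatMatrix.pairBool (encodingNatBool.pairBool encodingNatBool)).encode (⟨n, w⟩, (a, b))).length := by
  have h1 : n * n ≤ (encodingListNatBool.encode (MaxCutNP.entriesL n w)).length := by
    rw [congrFun (listE_eq encodingNatBool) (MaxCutNP.entriesL n w)]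
    simp only [listE, length_boolPair, length_unE, MaxCutNP.length_entriesL]
    omega
  rw [heisenbergSparsestCut_instEnc_encode, length_boolPair, length_boolPair]
  nlinarith [Nat.le_mul_self n]

/-- **A string passing the code tests is the code of a gap instance**: well paired, `⟨fstF x, bin 0⟩` a weighted-graph code,
`sndF x` a well-paired pair of canonical numerals. [folklore] -/
theorem heisenbergSparsestCut_code_of_tests {x : List Bool} (hwp : boolPair (fstF x) (sndF x) = x)
    (hm : MaxCutNP.CodeOK (boolPair (fstF x) (encodeNat 0)))
    (hwp2 : boolPair (fstF (sndF x)) (sndF (sndF x)) = sndF x) (ha : canonF (fstF (sndF x)) = fstF (sndF x))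
    (hb : canonF (sndF (sndF x)) = sndF (sndF x)) :
    ∃ (n : ℕ) (w : Fin n → Fin n → ℕ) (a b : ℕ),
      x = (encodingNatMatrix.pairBool (encodingNatBool.pairBool encodingNatBool)).encode (⟨n, w⟩, (a, b)) := by
  obtain ⟨n, w, W, hW⟩ := MaxCutNP.exists_eq_encode_of_codeOK hm
  have hfx : fstF x = boolPair (encodeNat n) (encodingListNatBool.encode (MaxCutNP.entriesL n w)) := by
    have h := congrArg fstF hW
    rwa [fstF_boolPair, MaxCutNP.instEnc_encode_eq, fstF_boolPair] at h
  refine ⟨n, w, decodeNat (fstF (sndF x)), decodeNat (sndF (sndF x)), ?_⟩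
  rw [heisenbergSparsestCut_instEnc_encode, ← hfx, ← canonF_eq_encodeNat_decodeNat, ← canonF_eq_encodeNat_decodeNat, ha, hb,
    hwp2, hwp]

/-- **`SparsestCutDecisionInNP` (stmt-PneNP-2290)**: the YES-language of the sparsest-cut gap problem is in `NP` — by the
definition `NP = ∃^poly P`, with certificate the characteristic vector of the cut and a typed polynomial-time verifier
(code tests, then `0 < dem S ∧ cap S · b ≤ a · dem S` by one pass over the `n²` entries).
[cite: Karp1972, §4 Main Theorem, problem 21] [cite: AroraBarakCC2009, Def. 2.1] -/
theorem heisenbergSparsestCut_sparsestCutDecisionInNP_proof :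
    Summit.PneNP.PneNP.Theses.HeisenbergSparsestCut.SparsestCutDecisionInNP := by
  -- the two cut sums, abbreviated
  set cs : Bool → ((List ℕ × List Bool) × ℕ) × ℕ → ℕ := fun upper r =>
    (((List.range (min r.1.2 r.2)).product (List.range (min r.1.2 r.2))).map fun ij : ℕ × ℕ =>
      if r.1.1.2.getD ij.1 false && !r.1.1.2.getD ij.2 false then
        (if (decide (ij.1 < ij.2) == upper) then r.1.1.1.getD (ij.1 * r.1.2 + ij.2) 0
          else r.1.1.1.getD (ij.2 * r.1.2 + ij.1) 0)
      else 0).sum with hcs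
  have hsum : ∀ upper, CodeFP (pairE (pairE (pairE (rawE natE) strE) natE) unE) natE (cs upper) := fun upper => by
    simp only [hcs]; exact heisenbergSparsestCut_codeFP_cutSum upper
  -- the cut test `0 < dem ∧ cap · b ≤ a · dem` on `((((E, y), n), B), (a, b))`
  have htest : CodeFP (pairE (pairE (pairE (pairE (rawE natE) strE) natE) unE) (pairE natE natE)) bitE
      fun s : (((List ℕ × List Bool) × ℕ) × ℕ) × (ℕ × ℕ) =>
        decide (0 < cs false s.1) && decide (cs true s.1 * s.2.2 ≤ s.2.1 * cs false s.1) := by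
    have hdem : CodeFP (pairE (pairE (pairE (pairE (rawE natE) strE) natE) unE) (pairE natE natE)) natE
        fun s : (((List ℕ × List Bool) × ℕ) × ℕ) × (ℕ × ℕ) => cs false s.1 := (hsum false).comp (CodeFP.fst _ _)
    have hcap : CodeFP (pairE (pairE (pairE (pairE (rawE natE) strE) natE) unE) (pairE natE natE)) natE
        fun s : (((List ℕ × List Bool) × ℕ) × ℕ) × (ℕ × ℕ) => cs true s.1 := (hsum true).comp (CodeFP.fst _ _)
    have ha : CodeFP (pairE (pairE (pairE (pairE (rawE natE) strE) natE) unE) (pairE natE natE)) natE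
        fun s : (((List ℕ × List Bool) × ℕ) × ℕ) × (ℕ × ℕ) => s.2.1 := (CodeFP.snd _ _).fst'
    have hb : CodeFP (pairE (pairE (pairE (pairE (rawE natE) strE) natE) unE) (pairE natE natE)) natE
        fun s : (((List ℕ × List Bool) × ℕ) × ℕ) × (ℕ × ℕ) => s.2.2 := (CodeFP.snd _ _).snd'
    exact (natLt.comp ((CodeFP.const _ 0).pair hdem) :).and
      (natLe.comp ((natMul.comp (hcap.pair hb)).pair (natMul.comp (ha.pair hdem))) :)
  -- string-level pieces
  have hfst : CodeFP strE strE fun w : List Bool => fstF w := CodeFP.of_fn fstF fstF_mem_FP fun _ => rfl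
  have hsnd : CodeFP strE strE fun w : List Bool => sndF w := CodeFP.of_fn sndF sndF_mem_FP fun _ => rfl
  have hdec : CodeFP strE natE fun w : List Bool => decodeNat w :=
    CodeFP.of_fn canonF canonF_mem_FP canonF_eq_encodeNat_decodeNat
  have hwp : CodeFP strE bitE fun w : List Bool => decide (boolPair (fstF w) (sndF w) = w) :=
    CodeFP.of_fn CliqueNP.wpF CliqueNP.wpF_mem_FP fun w => by rw [CliqueNP.wpF_apply]; rfl
  have hcanT : CodeFP strE bitE fun w : List Bool => decide (canonF w = w) :=
    CodeFP.of_fn CliqueNP.canT CliqueNP.canT_mem_FP fun w => by rw [CliqueNP.canT_apply]; rfl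
  have hmc : CodeFP strE bitE fun z : List Bool => decide (MaxCutNP.CodeOK (boolPair z (encodeNat 0))) :=
    CodeFP.of_fn (MaxCutNP.codeT ∘ fanoutFn id fun _ => encodeNat 0)
      (comp_mem_FP MaxCutNP.codeT_mem_FP (fanoutFn_mem_FP (PolyTimeComputable.id _) (const_mem_FP _))) fun z => by
        rw [Function.comp_apply, fanoutFn_apply, MaxCutNP.codeT_apply]; rfl
  have hcan : ∀ c : List Bool,
      encodingNatBool.listBool.decode c = some (NegCNF.decList decodeNat (boolUnpair c).1.length (boolUnpair c).2) ∧
        CanonCode.canonListFnC 2 canonF c =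
          encodingNatBool.listBool.encode (NegCNF.decList decodeNat (boolUnpair c).1.length (boolUnpair c).2) :=
    fun c => CanonCode.canonListFnC_eq encodingNatBool decodeNat (fun _ => rfl) canonF_eq_encodeNat_decodeNat
      (A := 1) (B := 1) (fun u => by have := length_canonF_le u; omega) (by norm_num) c
  have hdecl : ∀ l : List ℕ, NegCNF.decList decodeNat (boolUnpair (encodingListNatBool.encode l)).1.length
      (boolUnpair (encodingListNatBool.encode l)).2 = l := fun l => by
    have h := (hcan (encodingListNatBool.encode l)).1
    rw [encodingListNatBool.decode_encode] at h
    exact (Option.some.inj h).symm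
  have hlistC : CodeFP strE (listE natE) fun c : List Bool =>
      NegCNF.decList decodeNat (boolUnpair c).1.length (boolUnpair c).2 :=
    CodeFP.of_fn (CanonCode.canonListFnC 2 canonF) (CanonCode.canonListFnC_mem_FP 2 canonF_mem_FP) fun c =>
      (hcan c).2.trans (congrFun (listE_eq encodingNatBool) _)
  have hlist : CodeFP strE (rawE natE) fun c : List Bool =>
      NegCNF.decList decodeNat (boolUnpair c).1.length (boolUnpair c).2 := ((rawOfList natE).comp hlistC :)
  -- the typed verifier on `(x, y)`
  have hx : CodeFP (pairE strE strE) strE fun t : List Bool × List Bool => t.1 := CodeFP.fst _ _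
  have hy : CodeFP (pairE strE strE) strE fun t : List Bool × List Bool => t.2 := CodeFP.snd _ _
  have hx1 : CodeFP (pairE strE strE) strE fun t : List Bool × List Bool => fstF t.1 := (hfst.comp hx :)
  have hx2 : CodeFP (pairE strE strE) strE fun t : List Bool × List Bool => sndF t.1 := (hsnd.comp hx :)
  have hx21 : CodeFP (pairE strE strE) strE fun t : List Bool × List Bool => fstF (sndF t.1) := (hfst.comp hx2 :)
  have hx22 : CodeFP (pairE strE strE) strE fun t : List Bool × List Bool => sndF (sndF t.1) := (hsnd.comp hx2 :)
  have hn : CodeFP (pairE strE strE) natE fun t : List Bool × List Bool => decodeNat (fstF (fstF t.1)) :=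
    (hdec.comp (hfst.comp hx1) :)
  have hE : CodeFP (pairE strE strE) (rawE natE) fun t : List Bool × List Bool =>
      NegCNF.decList decodeNat (boolUnpair (sndF (fstF t.1))).1.length (boolUnpair (sndF (fstF t.1))).2 :=
    (hlist.comp (hsnd.comp hx1) :)
  have ha : CodeFP (pairE strE strE) natE fun t : List Bool × List Bool => decodeNat (fstF (sndF t.1)) := (hdec.comp hx21 :)
  have hb : CodeFP (pairE strE strE) natE fun t : List Bool × List Bool => decodeNat (sndF (sndF t.1)) := (hdec.comp hx22 :)
  have hB : CodeFP (pairE strE strE) unE fun t : List Bool × List Bool => t.1.length := (strLength.comp hx :)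
  have hcut := (htest.comp ((((hE.pair hy).pair hn).pair hB).pair (ha.pair hb)) :)
  have hQ := (hwp.comp hx :).and ((hmc.comp hx1 :).and ((hwp.comp hx2 :).and ((hcanT.comp hx21 :).and
    ((hcanT.comp hx22 :).and hcut))))
  obtain ⟨g, hg, hgspec⟩ := hQ
  -- the verifier language and its value
  set V : Language Bool := g ⁻¹' PRelSigma.HeadIs true with hV
  have hVP : V ∈ Classes.P := preimage_mem_P (PRelSigma.HeadIs_mem_P true) hg
  have hVraw : ∀ x y : List Bool, boolPair x y ∈ V ↔ (g (pairE strE strE (x, y))).head? = some true := fun _ _ => Iff.rfl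
  have hW : ∀ (n : ℕ) (w : Fin n → Fin n → ℕ) (upper : Bool),
      (fun i j : Fin n => if (decide (i < j) == upper) then w i j else w j i) =
        fun i j => if i < j then (if upper then w i j else w j i) else (if upper then w j i else w i j) := by
    intro n w upper; funext i j; cases upper <;> by_cases h : i < j <;> simp [h]
  have hVgen : ∀ (n : ℕ) (w : Fin n → Fin n → ℕ) (a b : ℕ) (y : List Bool),
      boolPair ((encodingNatMatrix.pairBool (encodingNatBool.pairBool encodingNatBool)).encode (⟨n, w⟩, (a, b))) y ∈ V ↔
        0 < cutWeight (fun i j => if i < j then w j i else w i j) (MaxCutNP.setOf n y) ∧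
          cutWeight (fun i j => if i < j then w i j else w j i) (MaxCutNP.setOf n y) * b ≤
            a * cutWeight (fun i j => if i < j then w j i else w i j) (MaxCutNP.setOf n y) := by
    intro n w a b y
    have hlen := heisenbergSparsestCut_n_le_length_encode n w a b
    have hm : MaxCutNP.CodeOK (boolPair (boolPair (encodeNat n) (encodingListNatBool.encode (MaxCutNP.entriesL n w)))
        (encodeNat 0)) := MaxCutNP.codeOK_encode n w 0
    rw [heisenbergSparsestCut_instEnc_encode] at hlen ⊢
    have hcsv : ∀ upper, cs upper (((MaxCutNP.entriesL n w, y), n),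
        (boolPair (boolPair (encodeNat n) (encodingListNatBool.encode (MaxCutNP.entriesL n w)))
          (boolPair (encodeNat a) (encodeNat b))).length) =
        cutWeight (fun i j : Fin n => if (decide (i < j) == upper) then w i j else w j i) (MaxCutNP.setOf n y) := by
      intro upper
      simp only [hcs]
      rw [min_eq_left hlen]
      exact heisenbergSparsestCut_cutSumL_eq_cutWeight upper n w y
    rw [hVraw, hgspec]
    simp only [bitE, List.head?_cons, Option.some.injEq]
    simp only [fstF_boolPair, sndF_boolPair, Computability.decode_encodeNat, hdecl, hcsv, hW, CliqueNP.canonF_encodeNat, hm,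
      decide_true, Bool.true_and, Bool.and_eq_true, decide_eq_true_eq]
    simp
  have hVcode : ∀ x y : List Bool, boolPair x y ∈ V → ∃ (n : ℕ) (w : Fin n → Fin n → ℕ) (a b : ℕ),
      x = (encodingNatMatrix.pairBool (encodingNatBool.pairBool encodingNatBool)).encode (⟨n, w⟩, (a, b)) := by
    intro x y h
    rw [hVraw, hgspec] at h
    simp only [bitE, List.head?_cons, Option.some.injEq, Bool.and_eq_true, decide_eq_true_eq] at h
    obtain ⟨hwp', hm', hwp2', ha', hb', -⟩ := h
    exact heisenbergSparsestCut_code_of_tests hwp' hm' hwp2' ha' hb'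
  -- NP by definition
  refine ⟨V, hVP, X, fun x => ?_⟩
  constructor
  · rintro ⟨⟨⟨n, w⟩, a, b⟩, hmem, rfl⟩
    obtain ⟨S, hS⟩ : ∃ S : Finset (Fin n), 0 < cutWeight (fun i j => if i < j then w j i else w i j) S ∧
        cutWeight (fun i j => if i < j then w i j else w j i) S * b ≤
          a * cutWeight (fun i j => if i < j then w j i else w i j) S := hmem
    refine ⟨List.ofFn fun i : Fin n => decide (i ∈ S), ?_, ?_⟩
    · rw [eval_X, List.length_ofFn]
      exact heisenbergSparsestCut_n_le_length_encode n w a b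
    · rw [hVgen, MaxCutNP.setOf_ofFn]
      exact hS
  · rintro ⟨y, -, hy⟩
    obtain ⟨n, w, a, b, rfl⟩ := hVcode x y hy
    exact ⟨(⟨n, w⟩, (a, b)), ⟨MaxCutNP.setOf n y, (hVgen n w a b y).1 hy⟩, rfl⟩

end Summit.PneNP.PneNP.Theorems
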